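import Mathlib.Analysis.Normed.Ring.Units
import Mathlib.Analysis.SpecificLimits.Normed
import Mathlib.Algebra.BigOperators.Group.List.Basic
import Mathlib.Tactic.NoncommRing
import HarnessLib

/-!
# Products of elements near the identity in a complete normed ring (Grauert–Remmert, Kap. III §1.2)

Grauert–Remmert, *Theorie der Steinschen Räume* (1977), Kap. III §1 Nr. 2 ("Beschränkte
holomorphe Matrizen"), proves for the algebra `B(V)` of bounded holomorphic `q × q` matrix
functions on an open set `V ⊆ ℂᵐ` (sup norm of the entries):

* a matrix `a` with `|a − e| ≤ s` is invertible with `|a⁻¹| ≤ 3` (Neumann series);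
* (#) `|a₀ a₁ ⋯ aₙ − e| ≤ 2 ∑ |a_ν − e|` as soon as `2 ∑ |a_ν − e| ≤ q⁻¹`, from the identity
  `a₀⋯aₙaₙ₊₁ − e = (a₀⋯aₙ − e)(aₙ₊₁ − e) + (a₀⋯aₙ − e) + (aₙ₊₁ − e)`;
* **Hilfssatz 2**: if `2 ∑ |g_ν| ≤ s` and `2 ∑ |h_ν| ≤ s`, the ordered products
  `uₙ = (e + g₀)(e + g₁)⋯(e + gₙ)` and `vₙ = (e + hₙ)⋯(e + h₁)(e + h₀)` converge uniformly to
  invertible matrices `u`, `v` with `|u − e| ≤ 2 ∑ |g_ν|`, `|v − e| ≤ 2 ∑ |h_ν|`.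

This is the convergence engine of Cartan's lemma on holomorphic matrices (loc. cit. §1.3,
Satz 4), itself an ingredient of Grauert's Oka principle. We prove the three statements in an
arbitrary complete normed ring `R` with `‖1‖ = 1` (the factors `q`, `q²` of GR disappear because
`‖·‖` is submultiplicative, so the thresholds become `2 ∑ ‖a_ν − 1‖ ≤ 1`): for `B(V)` with the
sup-over-`V` of any submultiplicative matrix norm this is GR's setting.

* `norm_inverse_le_of_norm_one_sub_lt` — `‖a⁻¹‖ ≤ (1 − ‖1 − a‖)⁻¹` for `‖1 − a‖ < 1`
  (`Ring.inverse`; `isUnit_of_norm_sub_one_lt`);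
* `norm_list_prod_sub_one_le` — (#) for any finite ordered product;
* `prodOneAdd g n = (1 + g 0) ⋯ (1 + g n)`, `prodOneAddRev g n = (1 + g n) ⋯ (1 + g 0)` and
  **Hilfssatz 2**: `exists_tendsto_prodOneAdd`, `exists_tendsto_prodOneAddRev` (limits `u`, `v`
  with `‖u − 1‖ ≤ 2 ∑' ‖g ν‖`; invertible when `2 ∑' ‖g ν‖ < 1`).

## References

* H. Grauert, R. Remmert, *Theorie der Steinschen Räume*, Grundlehren 227, Springer 1977,
  Kap. III §1.2 (Beschränkte holomorphe Matrizen; (#), Hilfssatz 2) [GrauertRemmert1977].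
-/

noncomputable section

open Filter
open scoped Topology

namespace Literature.Analysis.Complex

section NormedRing

variable {R : Type*} [NormedRing R]

/-! ### Inverses of elements near `1` -/

/-- An element `a` of a complete normed ring with `‖a − 1‖ < 1` is a unit (Neumann series
`a⁻¹ = ∑ (1 − a)ⁿ`; GR: "es existiert zu jeder Matrix `a` mit `|a − e| ≤ s` die inverse Matrix").
[cite: GrauertRemmert1977, Kap. III §1.2] -/
theorem isUnit_of_norm_sub_one_lt [CompleteSpace R] {a : R} (h : ‖a - 1‖ < 1) : IsUnit a := by
  have ha : a = 1 - (1 - a) := (sub_sub_cancel 1 a).symm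
  rw [ha]
  exact isUnit_one_sub_of_norm_lt_one (by rwa [norm_sub_rev])

/-- Norm of the inverse of an element near `1`: `‖a⁻¹‖ ≤ (1 − ‖1 − a‖)⁻¹` (GR: `|a⁻¹| ≤ 3` for
`|a − e| ≤ s`), the inverse being `Ring.inverse a = ∑ (1 − a)ⁿ`.
[cite: GrauertRemmert1977, Kap. III §1.2] -/
theorem norm_inverse_le_of_norm_one_sub_lt [CompleteSpace R] [NormOneClass R] {a : R}
    (h : ‖1 - a‖ < 1) : ‖Ring.inverse a‖ ≤ (1 - ‖1 - a‖)⁻¹ := by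
  have hgeom := geom_series_eq_inverse (1 - a) h
  rw [sub_sub_cancel] at hgeom
  rw [← hgeom]
  simpa using tsum_geometric_le_of_norm_lt_one (1 - a) h

/-! ### Finite ordered products: Grauert–Remmert's estimate (#) -/

/-- **GR (#).** For a finite ordered product in a normed ring,
`‖a₀ a₁ ⋯ aₙ − 1‖ ≤ 2 ∑ ‖a_ν − 1‖` provided `2 ∑ ‖a_ν − 1‖ ≤ 1` (induction on the identity
`a P − 1 = (a − 1)(P − 1) + (a − 1) + (P − 1)`). [cite: GrauertRemmert1977, Kap. III §1.2 (#)] -/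
theorem norm_list_prod_sub_one_le (l : List R) (h : 2 * (l.map fun a ↦ ‖a - 1‖).sum ≤ 1) :
    ‖l.prod - 1‖ ≤ 2 * (l.map fun a ↦ ‖a - 1‖).sum := by
  induction l with
  | nil => simp
  | cons a l ih =>
    simp only [List.map_cons, List.sum_cons, List.prod_cons] at h ⊢
    have h0 := norm_nonneg (a - 1)
    have hl : 2 * (l.map fun a ↦ ‖a - 1‖).sum ≤ 1 := by linarith
    have ih' := ih hl
    have hP1 : ‖l.prod - 1‖ ≤ 1 := ih'.trans hl
    have key : a * l.prod - 1 = (a - 1) * (l.prod - 1) + (a - 1) + (l.prod - 1) := by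
      noncomm_ring
    calc ‖a * l.prod - 1‖ = ‖(a - 1) * (l.prod - 1) + (a - 1) + (l.prod - 1)‖ := by rw [key]
      _ ≤ ‖a - 1‖ * ‖l.prod - 1‖ + ‖a - 1‖ + ‖l.prod - 1‖ :=
          (norm_add_le _ _).trans (add_le_add ((norm_add_le _ _).trans
            (add_le_add (norm_mul_le _ _) le_rfl)) le_rfl)
      _ ≤ ‖a - 1‖ * 1 + ‖a - 1‖ + 2 * (l.map fun a ↦ ‖a - 1‖).sum := by gcongr
      _ = 2 * (‖a - 1‖ + (l.map fun a ↦ ‖a - 1‖).sum) := by ring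

/-! ### Ordered infinite products: Hilfssatz 2 -/

/-- The ordered partial products `uₙ = (1 + g 0)(1 + g 1) ⋯ (1 + g n)` (new factors on the
RIGHT). [cite: GrauertRemmert1977, Kap. III §1.2 (Hilfssatz 2)] -/
def prodOneAdd (g : ℕ → R) : ℕ → R
  | 0 => 1 + g 0
  | n + 1 => prodOneAdd g n * (1 + g (n + 1))

/-- The ordered partial products `vₙ = (1 + g n) ⋯ (1 + g 1)(1 + g 0)` (new factors on the
LEFT). [cite: GrauertRemmert1977, Kap. III §1.2 (Hilfssatz 2)] -/
def prodOneAddRev (g : ℕ → R) : ℕ → R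
  | 0 => 1 + g 0
  | n + 1 => (1 + g (n + 1)) * prodOneAddRev g n

/-- `u₀ = 1 + g 0` (definitional). [folklore] -/
@[simp]
theorem prodOneAdd_zero (g : ℕ → R) : prodOneAdd g 0 = 1 + g 0 :=
  rfl

/-- `uₙ₊₁ = uₙ (1 + g (n+1))` (definitional). [folklore] -/
theorem prodOneAdd_succ (g : ℕ → R) (n : ℕ) :
    prodOneAdd g (n + 1) = prodOneAdd g n * (1 + g (n + 1)) :=
  rfl

/-- `v₀ = 1 + g 0` (definitional). [folklore] -/
@[simp]
theorem prodOneAddRev_zero (g : ℕ → R) : prodOneAddRev g 0 = 1 + g 0 :=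
  rfl

/-- `vₙ₊₁ = (1 + g (n+1)) vₙ` (definitional). [folklore] -/
theorem prodOneAddRev_succ (g : ℕ → R) (n : ℕ) :
    prodOneAddRev g (n + 1) = (1 + g (n + 1)) * prodOneAddRev g n :=
  rfl

/-- (#) for the partial products `uₙ`: `‖uₙ − 1‖ ≤ 2 ∑_{ν ≤ n} ‖g ν‖` if this is `≤ 1`.
[cite: GrauertRemmert1977, Kap. III §1.2 (#)] -/
theorem norm_prodOneAdd_sub_one_le (g : ℕ → R) (n : ℕ)
    (h : 2 * ∑ ν ∈ Finset.range (n + 1), ‖g ν‖ ≤ 1) :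
    ‖prodOneAdd g n - 1‖ ≤ 2 * ∑ ν ∈ Finset.range (n + 1), ‖g ν‖ := by
  induction n with
  | zero => simpa using (le_mul_of_one_le_left (norm_nonneg _) (by norm_num : (1 : ℝ) ≤ 2))
  | succ n ih =>
    rw [Finset.sum_range_succ] at h ⊢
    have h0 := norm_nonneg (g (n + 1))
    have hS : 0 ≤ ∑ ν ∈ Finset.range (n + 1), ‖g ν‖ := Finset.sum_nonneg fun _ _ ↦ norm_nonneg _
    have hn : 2 * ∑ ν ∈ Finset.range (n + 1), ‖g ν‖ ≤ 1 := by linarith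
    have ih' := ih hn
    have key : prodOneAdd g n * (1 + g (n + 1)) - 1 =
        (prodOneAdd g n - 1) * g (n + 1) + (prodOneAdd g n - 1) + g (n + 1) := by
      noncomm_ring
    rw [prodOneAdd_succ, key]
    calc ‖(prodOneAdd g n - 1) * g (n + 1) + (prodOneAdd g n - 1) + g (n + 1)‖
        ≤ ‖prodOneAdd g n - 1‖ * ‖g (n + 1)‖ + ‖prodOneAdd g n - 1‖ + ‖g (n + 1)‖ :=
          (norm_add_le _ _).trans (add_le_add ((norm_add_le _ _).trans
            (add_le_add (norm_mul_le _ _) le_rfl)) le_rfl)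
      _ ≤ 1 * ‖g (n + 1)‖ + 2 * ∑ ν ∈ Finset.range (n + 1), ‖g ν‖ + ‖g (n + 1)‖ := by
          gcongr
          exact ih'.trans hn
      _ = 2 * (∑ ν ∈ Finset.range (n + 1), ‖g ν‖ + ‖g (n + 1)‖) := by ring

/-- (#) for the reversed partial products `vₙ`: `‖vₙ − 1‖ ≤ 2 ∑_{ν ≤ n} ‖g ν‖` if this is `≤ 1`.
[cite: GrauertRemmert1977, Kap. III §1.2 (#)] -/
theorem norm_prodOneAddRev_sub_one_le (g : ℕ → R) (n : ℕ)
    (h : 2 * ∑ ν ∈ Finset.range (n + 1), ‖g ν‖ ≤ 1) :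
    ‖prodOneAddRev g n - 1‖ ≤ 2 * ∑ ν ∈ Finset.range (n + 1), ‖g ν‖ := by
  induction n with
  | zero => simpa using (le_mul_of_one_le_left (norm_nonneg _) (by norm_num : (1 : ℝ) ≤ 2))
  | succ n ih =>
    rw [Finset.sum_range_succ] at h ⊢
    have h0 := norm_nonneg (g (n + 1))
    have hS : 0 ≤ ∑ ν ∈ Finset.range (n + 1), ‖g ν‖ := Finset.sum_nonneg fun _ _ ↦ norm_nonneg _
    have hn : 2 * ∑ ν ∈ Finset.range (n + 1), ‖g ν‖ ≤ 1 := by linarith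
    have ih' := ih hn
    have key : (1 + g (n + 1)) * prodOneAddRev g n - 1 =
        g (n + 1) * (prodOneAddRev g n - 1) + (prodOneAddRev g n - 1) + g (n + 1) := by
      noncomm_ring
    rw [prodOneAddRev_succ, key]
    calc ‖g (n + 1) * (prodOneAddRev g n - 1) + (prodOneAddRev g n - 1) + g (n + 1)‖
        ≤ ‖g (n + 1)‖ * ‖prodOneAddRev g n - 1‖ + ‖prodOneAddRev g n - 1‖ + ‖g (n + 1)‖ :=
          (norm_add_le _ _).trans (add_le_add ((norm_add_le _ _).trans
            (add_le_add (norm_mul_le _ _) le_rfl)) le_rfl)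
      _ ≤ ‖g (n + 1)‖ * 1 + 2 * ∑ ν ∈ Finset.range (n + 1), ‖g ν‖ + ‖g (n + 1)‖ := by
          gcongr
          exact ih'.trans hn
      _ = 2 * (∑ ν ∈ Finset.range (n + 1), ‖g ν‖ + ‖g (n + 1)‖) := by ring

variable [CompleteSpace R] [NormOneClass R]

/-- Common convergence argument for Hilfssatz 2: a sequence `P` with `‖Pₙ − 1‖ ≤ 2 ∑_{ν≤n} ‖g ν‖`
and `‖Pₙ₊₁ − Pₙ‖ ≤ ‖Pₙ‖ ‖g (n+1)‖` (or `‖g (n+1)‖ ‖Pₙ‖`), where `∑ ‖g ν‖` converges with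
`2 ∑ ‖g ν‖ ≤ 1`, is Cauchy, and its limit `u` satisfies `‖u − 1‖ ≤ 2 ∑' ‖g ν‖`. [folklore] -/
private theorem exists_tendsto_of_bounds {g : ℕ → R} (hg : Summable fun ν ↦ ‖g ν‖)
    (hS : 2 * ∑' ν, ‖g ν‖ ≤ 1) (P : ℕ → R)
    (hP1 : ∀ n, 2 * ∑ ν ∈ Finset.range (n + 1), ‖g ν‖ ≤ 1 →
      ‖P n - 1‖ ≤ 2 * ∑ ν ∈ Finset.range (n + 1), ‖g ν‖)
    (hstep : ∀ n, ‖P (n + 1) - P n‖ ≤ ‖P n‖ * ‖g (n + 1)‖) :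
    ∃ u : R, Tendsto P atTop (𝓝 u) ∧ ‖u - 1‖ ≤ 2 * ∑' ν, ‖g ν‖ := by
  have hpart : ∀ n, ∑ ν ∈ Finset.range (n + 1), ‖g ν‖ ≤ ∑' ν, ‖g ν‖ := fun n ↦
    hg.sum_le_tsum _ fun _ _ ↦ norm_nonneg _
  have hP1' : ∀ n, ‖P n - 1‖ ≤ 2 * ∑ ν ∈ Finset.range (n + 1), ‖g ν‖ := fun n ↦
    hP1 n ((mul_le_mul_of_nonneg_left (hpart n) (by norm_num)).trans hS)
  have hPle : ∀ n, ‖P n‖ ≤ 2 := fun n ↦ by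
    calc ‖P n‖ = ‖(P n - 1) + 1‖ := by rw [sub_add_cancel]
      _ ≤ ‖P n - 1‖ + ‖(1 : R)‖ := norm_add_le _ _
      _ ≤ 1 + 1 := by
          rw [norm_one]
          exact add_le_add ((hP1' n).trans
            ((mul_le_mul_of_nonneg_left (hpart n) (by norm_num)).trans hS)) le_rfl
      _ = 2 := by norm_num
  have hdist : ∀ n, dist (P n) (P (n + 1)) ≤ 2 * ‖g (n + 1)‖ := fun n ↦ by
    rw [dist_comm, dist_eq_norm]
    exact (hstep n).trans (mul_le_mul_of_nonneg_right (hPle n) (norm_nonneg _))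
  have hsum : Summable fun n ↦ 2 * ‖g (n + 1)‖ :=
    ((summable_nat_add_iff 1).2 hg).mul_left 2
  obtain ⟨u, hu⟩ := cauchySeq_tendsto_of_complete (cauchySeq_of_dist_le_of_summable _ hdist hsum)
  refine ⟨u, hu, ?_⟩
  have hlim : Tendsto (fun n ↦ ‖P n - 1‖) atTop (𝓝 ‖u - 1‖) := (hu.sub_const 1).norm
  exact le_of_tendsto' hlim fun n ↦
    (hP1' n).trans (mul_le_mul_of_nonneg_left (hpart n) (by norm_num))

/-- **Grauert–Remmert, Kap. III §1.2, Hilfssatz 2 (products with new factors on the right).**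
In a complete normed ring with `‖1‖ = 1`, if `∑ ‖g ν‖` converges and `2 ∑ ‖g ν‖ ≤ 1`, the ordered
products `uₙ = (1 + g 0) ⋯ (1 + g n)` converge to some `u` with `‖u − 1‖ ≤ 2 ∑ ‖g ν‖`.
[cite: GrauertRemmert1977, Kap. III §1.2 (Hilfssatz 2)] -/
theorem exists_tendsto_prodOneAdd {g : ℕ → R} (hg : Summable fun ν ↦ ‖g ν‖)
    (hS : 2 * ∑' ν, ‖g ν‖ ≤ 1) :
    ∃ u : R, Tendsto (prodOneAdd g) atTop (𝓝 u) ∧ ‖u - 1‖ ≤ 2 * ∑' ν, ‖g ν‖ := by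
  refine exists_tendsto_of_bounds hg hS (prodOneAdd g) (norm_prodOneAdd_sub_one_le g) fun n ↦ ?_
  rw [prodOneAdd_succ, mul_add, mul_one, add_sub_cancel_left]
  exact norm_mul_le _ _

/-- **Grauert–Remmert, Kap. III §1.2, Hilfssatz 2 (products with new factors on the left).**
Under the same hypotheses the ordered products `vₙ = (1 + g n) ⋯ (1 + g 0)` converge to some
`v` with `‖v − 1‖ ≤ 2 ∑ ‖g ν‖`. [cite: GrauertRemmert1977, Kap. III §1.2 (Hilfssatz 2)] -/
theorem exists_tendsto_prodOneAddRev {g : ℕ → R} (hg : Summable fun ν ↦ ‖g ν‖)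
    (hS : 2 * ∑' ν, ‖g ν‖ ≤ 1) :
    ∃ v : R, Tendsto (prodOneAddRev g) atTop (𝓝 v) ∧ ‖v - 1‖ ≤ 2 * ∑' ν, ‖g ν‖ := by
  refine exists_tendsto_of_bounds hg hS (prodOneAddRev g) (norm_prodOneAddRev_sub_one_le g)
    fun n ↦ ?_
  rw [prodOneAddRev_succ, add_mul, one_mul, add_sub_cancel_left]
  exact (norm_mul_le _ _).trans_eq (mul_comm _ _)

/-- The limits in Hilfssatz 2 are units as soon as `2 ∑ ‖g ν‖ < 1` (GR: "`u, v ∈ B*(V)`").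
[cite: GrauertRemmert1977, Kap. III §1.2 (Hilfssatz 2)] -/
theorem exists_tendsto_prodOneAdd_isUnit {g : ℕ → R} (hg : Summable fun ν ↦ ‖g ν‖)
    (hS : 2 * ∑' ν, ‖g ν‖ < 1) :
    (∃ u : R, IsUnit u ∧ Tendsto (prodOneAdd g) atTop (𝓝 u) ∧ ‖u - 1‖ ≤ 2 * ∑' ν, ‖g ν‖) ∧
    (∃ v : R, IsUnit v ∧ Tendsto (prodOneAddRev g) atTop (𝓝 v) ∧ ‖v - 1‖ ≤ 2 * ∑' ν, ‖g ν‖) := by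
  obtain ⟨u, hu, hu1⟩ := exists_tendsto_prodOneAdd hg hS.le
  obtain ⟨v, hv, hv1⟩ := exists_tendsto_prodOneAddRev hg hS.le
  exact ⟨⟨u, isUnit_of_norm_sub_one_lt (hu1.trans_lt hS), hu, hu1⟩,
    ⟨v, isUnit_of_norm_sub_one_lt (hv1.trans_lt hS), hv, hv1⟩⟩

end NormedRing

end Literature.Analysis.Complex

end
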